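import Literature.NumberTheory.Automorphic.AutomorphicRepsGLSatakeFlathProofs
import Literature.NumberTheory.Automorphic.SatakeParamNeZeroProofs
import Literature.NumberTheory.Automorphic.ChebotarevArtinRepHolds
import Literature.NumberTheory.GaloisRepresentations.LAdicRepFrobenius
import Literature.NumberTheory.GaloisRepresentations.IntegralGaloisAction
import Summits.Langlands.Langlands.Theorems.IrreducibilityBySelfDualityEssSelfDualIrreducibleCMFrobenius
import HarnessLib

/-!
# `EssSelfDualIrreducibleCM` — the character identity on `Γ_K` (Chebotarev density + continuity)

Helper file for the item `EssSelfDualIrreducibleCM` (stmt-Langlands-13618) of the route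
`IrreducibilityBySelfDuality`: `trace_identity` — with `t_{π,v} = d_v · Ad(t_{σ,v})` almost
everywhere and `ρ₁`, `ψ`, `r` the `ℓ`-adic representations compatible with `σ`, `ν`, `π`, the identity
`tr r(g) · χ_cyc(g) ψ(g)⁻¹ + 1 = tr ρ₁(g) · tr ρ₁(g⁻¹)` holds for EVERY `g ∈ Γ_K`: it holds at the
Frobenii over a cofinite set of places (`trace_identity_of_charpoly_eq`), these are dense
(`absoluteGaloisGroup.frobenius_dense`, fed with the tree's proved Chebotarev theorem
`chebotarev_artinRep_holds`), and both sides are continuous.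
-/

noncomputable section

set_option linter.dupNamespace false -- project-wide option (lakefile weak.linter.dupNamespace); `Summit.Langlands.Langlands` is the mandated namespace

open scoped NumberField
open Matrix Polynomial Filter IsDedekindDomain Field
open Literature.NumberTheory.Automorphic Literature.NumberTheory.GaloisRepresentations

namespace Summit.Langlands.Langlands.Theorems.EssSelfDualIrreducibleCM

/-! ### The trace identity on all of `Γ_K` (Chebotarev density + continuity) -/

/-- **The character identity `χ_r · (χ_cyc ψ⁻¹) + 1 = χ_{ρ₁} · χ_{ρ₁^∨}` on `Γ_K`.**  Let `π` (on
`GL₃`), `σ` (on `GL₂`), `ν` (on `GL₁`) be automorphic data over the number field `K` with, almost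
everywhere, `t_{π,v} = d_v · Ad(t_{σ,v})` (`ν` Satake `{d_v}`); let `ρ₁`, `ψ` be `ℓ`-adic
representations compatible with `σ`, `ν` at every unramified `v ∤ ℓ` (C-normalisation
`arithFrobPolyOfSatake ι q_v n`), `cyc` the `ℚ̄_ℓ`-valued cyclotomic character, and `r` a rank-3
representation compatible with `π` almost everywhere.  Then for EVERY `g ∈ Γ_K`:
`tr r(g) · χ_cyc(g) ψ(g)⁻¹ + 1 = tr ρ₁(g) · tr ρ₁(g⁻¹)`.  At a Frobenius over a good place this is
`trace_identity_of_charpoly_eq`; both sides are continuous and the good Frobenii are dense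
(Chebotarev, `absoluteGaloisGroup.frobenius_dense` fed with the proved `chebotarev_artinRep_holds`).
[folklore] -/
theorem trace_identity {K : Type} [Field K] [NumberField K] {ℓ : ℕ} [Fact ℓ.Prime]
    (ι : PadicAlgCl ℓ ≃+* ℂ)
    {h1 : isCompact_glFiniteIntegralLevel 1 K} {hcpt₂ : isCompact_glFiniteIntegralLevel 2 K}
    {hcpt : isCompact_glFiniteIntegralLevel 3 K}
    (π : CuspidalAutomorphicRepData 3 K hcpt) (σ : CuspidalAutomorphicRepData 2 K hcpt₂)
    (ν : CuspidalAutomorphicRepData 1 K h1)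
    (hAd : ∀ᶠ v : HeightOneSpectrum (𝓞 K) in cofinite, ∀ α β : Multiset ℂ, π.1.HasSatakeParamAt v α →
      σ.1.HasSatakeParamAt v β → ∃ d : ℂ, ν.1.HasSatakeParamAt v {d} ∧
        α = (((β ×ˢ β).map (fun p : ℂ × ℂ => p.1 * p.2⁻¹)).erase 1).map (fun c => d * c))
    (ρ₁ : FramedGaloisRep K (PadicAlgCl ℓ) 2)
    (hρ₁ : ∀ (v : HeightOneSpectrum (𝓞 K)) (β : Multiset ℂ), σ.1.HasSatakeParamAt v β →
      ((ℓ : ℕ) : 𝓞 K) ∉ v.asIdeal → ρ₁.IsUnramifiedAt v ∧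
        ρ₁.HasFrobCharpolyAt v (arithFrobPolyOfSatake ι v.residueCard 2 β))
    (ψ : FramedGaloisRep K (PadicAlgCl ℓ) 1)
    (hψ : ∀ (v : HeightOneSpectrum (𝓞 K)) (γ : Multiset ℂ), ν.1.HasSatakeParamAt v γ →
      ((ℓ : ℕ) : 𝓞 K) ∉ v.asIdeal → ψ.IsUnramifiedAt v ∧
        ψ.HasFrobCharpolyAt v (arithFrobPolyOfSatake ι v.residueCard 1 γ))
    (cyc : FramedGaloisRep K (PadicAlgCl ℓ) 1)
    (hcyc : ∀ g : absoluteGaloisGroup K,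
      ((cyc g : GL (Fin 1) (PadicAlgCl ℓ)) : Matrix (Fin 1) (Fin 1) (PadicAlgCl ℓ)) 0 0 =
        algebraMap ℚ_[ℓ] (PadicAlgCl ℓ) (((GaloisRep.cyclotomicCharacter K ℓ g : ℤ_[ℓ]ˣ) : ℤ_[ℓ]) : ℚ_[ℓ]))
    (r : FramedGaloisRep K (PadicAlgCl ℓ) 3)
    (hr : ∀ᶠ v : HeightOneSpectrum (𝓞 K) in cofinite, ∀ α : Multiset ℂ, π.1.HasSatakeParamAt v α →
      r.IsUnramifiedAt v ∧ r.HasFrobCharpolyAt v (arithFrobPolyOfSatake ι v.residueCard 3 α))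
    (g : absoluteGaloisGroup K) :
    FramedRep.trace r g * ((FramedRep.det cyc * (FramedRep.det ψ)⁻¹) g : PadicAlgCl ℓ) + 1 =
      FramedRep.trace ρ₁ g * FramedRep.trace ρ₁ g⁻¹ := by
  classical
  set cχ : absoluteGaloisGroup K →ₜ* (PadicAlgCl ℓ)ˣ := FramedRep.det cyc * (FramedRep.det ψ)⁻¹ with hcχ
  have hcχg : ∀ g, (cχ g : PadicAlgCl ℓ) =
      ((cyc g : GL (Fin 1) (PadicAlgCl ℓ)) : Matrix (Fin 1) (Fin 1) (PadicAlgCl ℓ)) 0 0 *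
        (((ψ g : GL (Fin 1) (PadicAlgCl ℓ)) : Matrix (Fin 1) (Fin 1) (PadicAlgCl ℓ)) 0 0)⁻¹ := fun g => by
    rw [hcχ, ContinuousMonoidHom.mul_apply, Units.val_mul]
    change (FramedRep.det cyc g : PadicAlgCl ℓ) * (((FramedRep.det ψ g)⁻¹ : (PadicAlgCl ℓ)ˣ) : PadicAlgCl ℓ) = _
    rw [Units.val_inv_eq_inv_val, FramedRep.det_apply, FramedRep.det_apply,
      Matrix.GeneralLinearGroup.val_det_apply, Matrix.GeneralLinearGroup.val_det_apply, Matrix.det_fin_one,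
      Matrix.det_fin_one]
  -- the good places
  have hπc : ∀ᶠ v : HeightOneSpectrum (𝓞 K) in cofinite, π.1.IsUnramifiedAt v :=
    AutomorphicRepData.hasSatakeParamAt_cofinite_holds π.1
  have hσc : ∀ᶠ v : HeightOneSpectrum (𝓞 K) in cofinite, σ.1.IsUnramifiedAt v :=
    AutomorphicRepData.hasSatakeParamAt_cofinite_holds σ.1
  set good : HeightOneSpectrum (𝓞 K) → Prop := fun v =>
    ((ℓ : ℕ) : 𝓞 K) ∉ v.asIdeal ∧ π.1.IsUnramifiedAt v ∧ σ.1.IsUnramifiedAt v ∧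
      (∀ α : Multiset ℂ, π.1.HasSatakeParamAt v α →
        r.IsUnramifiedAt v ∧ r.HasFrobCharpolyAt v (arithFrobPolyOfSatake ι v.residueCard 3 α)) ∧
      (∀ α β : Multiset ℂ, π.1.HasSatakeParamAt v α → σ.1.HasSatakeParamAt v β → ∃ d : ℂ,
        ν.1.HasSatakeParamAt v {d} ∧
          α = (((β ×ˢ β).map (fun p : ℂ × ℂ => p.1 * p.2⁻¹)).erase 1).map (fun c => d * c))
    with hgood_def
  have hgood : ∀ᶠ v in cofinite, good v := by
    filter_upwards [FramedGaloisRep.eventually_natCast_not_mem K ℓ, hπc, hσc, hr, hAd]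
      with v h1' h2' h3' h4' h5'
    exact ⟨h1', h2', h3', h4', h5'⟩
  set S : Set (HeightOneSpectrum (𝓞 K)) := {v | ¬ good v} with hS
  have hSfin : S.Finite := Filter.eventually_cofinite.1 hgood
  -- both sides are continuous functions of `g`
  set F₁ : absoluteGaloisGroup K → PadicAlgCl ℓ := fun g =>
    FramedRep.trace r g * (cχ g : PadicAlgCl ℓ) + 1 with hF₁
  set F₂ : absoluteGaloisGroup K → PadicAlgCl ℓ := fun g =>
    FramedRep.trace ρ₁ g * FramedRep.trace ρ₁ g⁻¹ with hF₂
  have hF₁c : Continuous F₁ :=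
    ((FramedRep.continuous_trace r).mul (Units.continuous_val.comp (map_continuous cχ))).add
      continuous_const
  have hF₂c : Continuous F₂ :=
    (FramedRep.continuous_trace ρ₁).mul ((FramedRep.continuous_trace ρ₁).comp continuous_inv)
  -- the identity holds on Frobenii over good places
  have hfrob : {g : absoluteGaloisGroup K | ∃ v ∉ S, ∃ 𝔓 ∈ v.primesAbove, IsArithFrobAt (𝓞 K) g 𝔓} ⊆
      {g | F₁ g = F₂ g} := by
    rintro g ⟨v, hv, 𝔓, h𝔓, hg⟩
    simp only [hS, Set.mem_setOf_eq, not_not] at hv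
    obtain ⟨hℓ, ⟨α, hα⟩, ⟨β, hβ⟩, hrv, hAdv⟩ := hv
    obtain ⟨d, hνd, hαeq⟩ := hAdv α β hα hβ
    obtain ⟨x, y, rfl⟩ := Multiset.card_eq_two.mp hβ.card_eq
    have hx : x ≠ 0 := hasSatakeParamAt_ne_zero_holds hβ x (by simp)
    have hy : y ≠ 0 := hasSatakeParamAt_ne_zero_holds hβ y (by simp)
    have hd : d ≠ 0 := hasSatakeParamAt_ne_zero_holds hνd d (by simp)
    have hq : v.residueCard ≠ 0 := by
      have := HeightOneSpectrum.one_lt_residueCard v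
      omega
    have h₃ : FramedRep.charpoly r g =
        arithFrobPolyOfSatake ι v.residueCard 3 {d * (x * y⁻¹), d * (y * x⁻¹), d} := by
      rw [← adParams_pair hx hy d, ← hαeq]
      exact (hrv α hα).2 𝔓 h𝔓 g hg
    have h₂ : FramedRep.charpoly ρ₁ g = arithFrobPolyOfSatake ι v.residueCard 2 {x, y} :=
      (hρ₁ v _ hβ hℓ).2 𝔓 h𝔓 g hg
    have hψg : (((ψ g : GL (Fin 1) (PadicAlgCl ℓ)) : Matrix (Fin 1) (Fin 1) (PadicAlgCl ℓ)) 0 0) =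
        ι.symm d⁻¹ := by
      have h := (hψ v {d} hνd hℓ).2
      rw [arithFrobPolyOfSatake_one, Multiset.map_singleton, Multiset.prod_singleton] at h
      exact (FramedGaloisRep.hasFrobCharpolyAt_iff_of_rank_one ψ v _).mp h 𝔓 h𝔓 g hg
    have hcycg : (((cyc g : GL (Fin 1) (PadicAlgCl ℓ)) : Matrix (Fin 1) (Fin 1) (PadicAlgCl ℓ)) 0 0) =
        (v.residueCard : PadicAlgCl ℓ) :=
      (FramedGaloisRep.hasFrobCharpolyAt_iff_of_rank_one cyc v _).mp
        (FramedGaloisRep.hasFrobCharpolyAt_natCast_of_cyclotomic cyc hcyc hℓ) 𝔓 h𝔓 g hg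
    show F₁ g = F₂ g
    simp only [hF₁, hF₂, hcχg, hψg, hcycg]
    unfold FramedRep.charpoly at h₃ h₂
    unfold FramedRep.trace
    rw [map_inv]
    exact trace_identity_of_charpoly_eq ι hq hx hy hd h₃ h₂
  -- density of good Frobenii and closedness of the coincidence set
  have hclosed : IsClosed {g : absoluteGaloisGroup K | F₁ g = F₂ g} := isClosed_eq hF₁c hF₂c
  have hmem : g ∈ closure {g : absoluteGaloisGroup K | ∃ v ∉ S, ∃ 𝔓 ∈ v.primesAbove,
      IsArithFrobAt (𝓞 K) g 𝔓} := by
    rw [(absoluteGaloisGroup.frobenius_dense chebotarev_artinRep_holds K S hSfin).closure_eq]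
    exact Set.mem_univ g
  exact hclosed.closure_subset_iff.2 hfrob hmem



end Summit.Langlands.Langlands.Theorems.EssSelfDualIrreducibleCM

end
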